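import Mathlib
import HarnessLib
import Summits.HubbardSuperconductivity.HubbardSuperconductivity.Theorems.KLProgrammeKLRegimeEngineV8E5BlockLabels
import Summits.HubbardSuperconductivity.HubbardSuperconductivity.Theorems.KLProgrammeKLRegimeWickCrossContractionPushforwardHybrid
import Summits.HubbardSuperconductivity.HubbardSuperconductivity.Theorems.KLProgrammeKLRegimeWickCrossContractionGramTailHybrid

/-!
# Route `KLProgramme` — ENGINE child gen 8 (stmt-HubbardSuperconductivity-20437 `KLRegimeEngineV17F2`), SKELETON v2 class #3, PROVING side:
# the E.5 block `klE5Block` bounded in HYBRID form — the (L, M)-UNIFORM glue of the `∃ (C,u), E5ShareStep2 P R C u` witness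
# (cell gate-hubbard-kl, seat p5 g8; cure of FINDING (E5-VOL); supersedes `…EngineV8E5Block` §2 / `…E5BlockLabels` §1, §5 as the witness's entry point)

FINDING (E5-VOL) (KL STATUS 2026-08-27 p5 g8): `norm_klE5Block_le_of_tails` (p544244) pushes the sector-field block forward by the ROW sums
`R = ρ₁·|SpaceTimeIdx|/(βL²)` of the substitution against a bound uniform in the sector-field tuple — `O(|SpaceTimeIdx|³)` too large.  Here the
push-forward uses the ENTRY bound `‖S(F̃) a b‖ ≤ ‖(βL²)⁻¹‖`, the `≤ ρ₁` admissible sector labels per external momentum, ONE free translation `|SpaceTimeIdx|`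
and the HYBRID tails of `…GramTailHybrid` (output labels prescribed, output positions summed, one pinned):

* §1 **`norm_klE5Block_le_of_hybridTails`** — for a thin/fat pair `(F, F̃)` whose plateau carries the two lines and the four pair labels:
  `‖klE5Block … Qm x y‖ ≤ 4!·|βL²|³·(‖(βL²)⁻¹‖⁴·(ρ₁⁴·(|SpaceTimeIdx|·Σ_s T s)))`, `T s` ≥ the `(i!)⁻¹`-weighted HYBRID tail of the sector-field two-vertex terms of
  the preimage at colouring `s` (pinned leg `p s`, uniform in the prescribed labels and the pinned position); net prefactor `4!·ρ₁⁴·(2M/β) = 4!·ρ₁⁴·ε⁻¹`,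
  against tails `T s = O(ε)` — volume-free;
* §2 **`norm_klE5Block_le_of_hybridTails_pointAugment`** — the same at ANY labels through the point-augmented pair ((E5-LABELS), cure (α); `ρ₁ + 4`);
* §3 **`klE5_hybridTail_le_of_lineData_pointAugment`** (`m₀ + 1 ≥ 1` legs of copy `0`, pinned there) and **`…_of_b`** (every leg of copy `1`) — the tails
  from the OLD line data (`α` row sums of the pulled-back `Ċ_Λ`, `δ` entries of the pulled-back `C∞ − C_Λ`, Gram `κ`, all w.r.t. `F̃`; symbols supported
  in the old plateau) and the carrier's MIXED level norms w.r.t. `pointAugment F e` at EXACTLY the prescriptions of `…E5BlockLabels` §2 (`hNa/hNb`);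
* §4 **`norm_klE5Block_le_of_hybridTails_klAniso`** — the INSTANCE OF RECORD (`klAnisoFamily … (m+1)` / `bgmFatMultiplier … (m+1)`, `m + 2 ≤ n₀`,
  `0 < Λ ≤ Λ_{n₀}`; multiplicity `9 + 4`): every family-side hypothesis discharged, only the hybrid tails `hT` left.

Pure composition; no definitions, no named facts, nothing about the model's sizes is asserted; nothing asserts superconductivity.
-/

noncomputable section

namespace Summit.HubbardSuperconductivity.HubbardSuperconductivity.Theorems.KLRegimeSplit

set_option linter.dupNamespace false -- summit = problem name (single-conjunct summit), D-0017

open Real Finset Literature.MathematicalPhysics.QuantumLattice Literature.Probability.LatticeModels GrassmannAlgebra Matrix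
open Literature.MathematicalPhysics.QuantumLattice.FermiRG
open Summit.HubbardSuperconductivity.HubbardSuperconductivity.Theorems.KLRegimeWick
open Summit.HubbardSuperconductivity.HubbardSuperconductivity.Theorems.EngineV8

/-! ## §1 The E.5 block from HYBRID tails -/

section BlockBound

variable {L M N : ℕ} [NeZero L] [NeZero M] (β μ : ℝ) (K : TrigPolyC4v) (n₀ : ℕ) (κ : FreqMomentum L M × Fin 2 → ℂ)
  (V : HubbardGrassmann L M) (Λ : ℝ) (Qm : TorusSite 2 L) (x y : TorusSite 2 L × MatsubaraIdx M)

omit [NeZero L] [NeZero M] in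
/-- The admissible sector labels of a physical leg `a = ((k,σ),c)` under the substitution `S(F̃)`: the `((ω,σ),c)` with `F̃_ω(k) ≠ 0`. -/
theorem sectorSubMatrix_ne_zero_mem_image (Ft : Fin N → FreqMomentum L M → ℂ) (a : HubbardFieldIdx L M) (b : SpaceTimeIdx L M × SectorLeg N)
    (h : sectorSubMatrix L M β Ft a b ≠ 0) :
    b.2 ∈ ((univ : Finset (Fin N)).filter fun ω => Ft ω a.1.1 ≠ 0).image fun ω => ((ω, a.1.2), a.2) := by
  classical
  rw [sectorSubMatrix_apply] at h
  split_ifs at h with hc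
  · have hF : Ft b.2.1.1 a.1.1 ≠ 0 := by
      intro h0
      exact h (by rw [h0, zero_mul, mul_zero])
    refine mem_image.2 ⟨b.2.1.1, mem_filter.2 ⟨mem_univ _, hF⟩, ?_⟩
    rw [hc.1, hc.2]
  · exact absurd rfl h

omit [NeZero L] [NeZero M] in
/-- Entries of the substitution `S(F̃)` are at most `‖(βL²)⁻¹‖` when `‖F̃‖ ≤ 1`. -/
theorem norm_sectorSubMatrix_apply_le (Ft : Fin N → FreqMomentum L M → ℂ) (hFt : ∀ ω k, ‖Ft ω k‖ ≤ 1) (a : HubbardFieldIdx L M)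
    (b : SpaceTimeIdx L M × SectorLeg N) : ‖sectorSubMatrix L M β Ft a b‖ ≤ ‖((1 / (β * (L : ℝ) ^ 2) : ℝ) : ℂ)‖ := by
  rw [sectorSubMatrix_apply]
  split_ifs
  · rw [norm_mul, norm_mul, Complex.norm_conj, norm_hubbardPlaneWave, mul_one]
    exact mul_le_of_le_one_right (norm_nonneg _) (hFt _ _)
  · rw [norm_zero]; exact norm_nonneg _

/-- **The E.5 block bounded by colouring-wise HYBRID tails** (entry bound `‖(βL²)⁻¹‖`, `≤ ρ₁` admissible labels per leg, one free translation, dead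
variables, `𝒱₄ = 4!(βL²)³·kernel`): for a thin/fat pair `(F, F̃)` (`F̃·F = F`, `Σ_ω F_ω = 0 ⇒ F_ω = 0`, `‖F̃‖ ≤ 1`, multiplicity `ρ₁`) whose plateau carries both
legs of every nonzero entry of `Ċ_Λ` and `C∞ − C_Λ` and the four pair labels, and per-colouring bounds `T s` of the `(i!)⁻¹`-weighted HYBRID tail of the
sector-field two-vertex terms of `a′ = sectorPreimage β F W_Λ` (leg `p s` pinned at any position, every output label prescribed, uniformly in both):
`‖klE5Block … κ V Λ Qm x y‖ ≤ 4!·|βL²|³·(‖(βL²)⁻¹‖⁴·(ρ₁⁴·(|SpaceTimeIdx|·Σ_s T s)))`. [cite: BenfattoGiulianiMastropietro2006, §2.7 (2.70)] -/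
theorem norm_klE5Block_le_of_hybridTails (hβ : β ≠ 0) (F Ft : Fin N → FreqMomentum L M → ℂ)
    (hFF : ∀ ω k, Ft ω k * F ω k = F ω k) (hF0 : ∀ k, ∑ ω, F ω k = 0 → ∀ ω, F ω k = 0) (hFt : ∀ ω k, ‖Ft ω k‖ ≤ 1)
    {ρ₁ : ℕ} (hρ₁ : ∀ k : FreqMomentum L M, ((univ : Finset (Fin N)).filter fun ω => Ft ω k ≠ 0).card ≤ ρ₁)
    (hĊ : ∀ X Y, klE5DressedSliceDeriv L M β μ K n₀ κ Λ X Y ≠ 0 → ∑ ω, F ω X.1.1 = 1 ∧ ∑ ω, F ω Y.1.1 = 1)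
    (hD : ∀ X Y, (klE5Total L M β μ K n₀ κ - klE5DressedSlice L M β μ K n₀ κ Λ) X Y ≠ 0 → ∑ ω, F ω X.1.1 = 1 ∧ ∑ ω, F ω Y.1.1 = 1)
    (hx : ∑ ω, F ω (x.2, x.1) = 1) (hx' : ∑ ω, F ω (x.2.rev, Qm - x.1) = 1)
    (hy : ∑ ω, F ω (y.2, y.1) = 1) (hy' : ∑ ω, F ω (y.2.rev, Qm - y.1) = 1)
    (p : (Fin 4 → Fin 2) → Fin 4) (T : (Fin 4 → Fin 2) → ℝ) (hT0 : ∀ s, 0 ≤ T s)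
    (hT : ∀ (s : Fin 4 → Fin 2) (σ : Fin 4 → SectorLeg N) (xp : SpaceTimeIdx L M),
      ∑ i ∈ Finset.Icc 2 (Fintype.card (HubbardFieldIdx L M × Fin 2) + 1), ((i.factorial : ℝ))⁻¹ *
        ∑ Z ∈ univ.filter (fun Z : Fin 4 → SpaceTimeIdx L M × SectorLeg N => Z (p s) = (xp, σ (p s)) ∧ ∀ j, (Z j).2 = σ j),
        ‖kernel ℂ ((grassmannLaplacian ℂ (crossCov ℂ ((sectorSubMatrix L M β Ft).transpose *
              (klE5Total L M β μ K n₀ κ - klE5DressedSlice L M β μ K n₀ κ Λ) * sectorSubMatrix L M β Ft)) ^ i *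
            grassmannLaplacian ℂ (crossCov ℂ ((sectorSubMatrix L M β Ft).transpose * klE5DressedSliceDeriv L M β μ K n₀ κ Λ *
              sectorSubMatrix L M β Ft)))
          (dblCopy ℂ 0 (sectorPreimage β F (klE5Carrier L M β μ K n₀ κ V Λ)) *
            dblCopy ℂ 1 (sectorPreimage β F (klE5Carrier L M β μ K n₀ κ V Λ)))) 4 (fun j => (Z j, s j))‖ ≤ T s) :
    ‖klE5Block L M β μ K n₀ κ V Λ Qm x y‖ ≤ ((4 : ℕ).factorial : ℝ) * |β * (L : ℝ) ^ 2| ^ 3 *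
      (‖((1 / (β * (L : ℝ) ^ 2) : ℝ) : ℂ)‖ ^ 4 * (((ρ₁ : ℝ)) ^ 4 * (Fintype.card (SpaceTimeIdx L M) * ∑ s : Fin 4 → Fin 2, T s))) := by
  classical
  -- notation
  set W : HubbardGrassmann L M := klE5Carrier L M β μ K n₀ κ V Λ with hW
  set r : HubbardFieldIdx L M → ℂ := fun X => ∑ ω, F ω X.1.1 with hr
  set X' : Fin 4 → HubbardFieldIdx L M :=
    ![(((y.2, y.1), 0), 0), (((y.2.rev, Qm - y.1), 1), 0), (((x.2.rev, Qm - x.1), 1), 1), (((x.2, x.1), 0), 1)] with hX'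
  have hX'r : ∀ i, r (X' i) = 1 := by
    intro i
    fin_cases i
    · exact hy
    · exact hy'
    · exact hx'
    · exact hx
  -- (1) dead variables: replace both copies of `W` by `S_r W`
  have h1 := kernel_dblFold_crossLaplacian_sum_pow_map_mulLeft_eq r (klE5DressedSliceDeriv L M β μ K n₀ κ Λ)
    (klE5Total L M β μ K n₀ κ - klE5DressedSlice L M β μ K n₀ κ Λ) (Finset.Icc 2 (Fintype.card (HubbardFieldIdx L M × Fin 2) + 1))
    (fun i => ((i.factorial : ℂ))⁻¹) W W X' hĊ hD hX'r
  -- (2) `S_r W` is the push-forward of the sector preimage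
  have h2 : ExteriorAlgebra.map (LinearMap.mulLeft ℂ r) W =
      ExteriorAlgebra.map (Matrix.toLin' (sectorSubMatrix L M β Ft)) (sectorPreimage β F W) :=
    (map_sectorSub_sectorPreimage_eq_map_mulLeft hβ F Ft hFF hF0 W).symm
  -- the admissible label sets and their size
  set Adm : HubbardFieldIdx L M → Finset (SectorLeg N) := fun a =>
    ((univ : Finset (Fin N)).filter fun ω => Ft ω a.1.1 ≠ 0).image fun ω => ((ω, a.1.2), a.2) with hAdm
  have hAdmCard : ∀ a, ((Adm a).card : ℝ) ≤ ρ₁ := fun a => by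
    exact_mod_cast card_image_le.trans (hρ₁ a.1.1)
  have hB0 : (0 : ℝ) ≤ ‖((1 / (β * (L : ℝ) ^ 2) : ℝ) : ℂ)‖ := norm_nonneg _
  -- (3) assemble
  unfold klE5Block
  rw [vertexFn_def, norm_mul, Complex.norm_real, Real.norm_eq_abs, abs_mul, abs_pow, Nat.abs_cast]
  simp only [Nat.add_one_sub_one]
  refine mul_le_mul_of_nonneg_left ?_ (by positivity)
  rw [← hW, ← hX', ← h1, h2]
  refine (norm_kernel_dblFold_crossLaplacian_sum_pow_map_le_of_hybridTails (sectorSubMatrix L M β Ft) _ _ _ _ _ _ X' hB0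
    (norm_sectorSubMatrix_apply_le β Ft hFt) Adm (fun a b hab => sectorSubMatrix_ne_zero_mem_image β Ft a b hab) p T
    fun s σ xp _ => ?_).trans ?_
  · refine le_trans (le_of_eq (sum_congr rfl fun i _ => ?_)) (hT s σ xp)
    rw [norm_inv_natCast_factorial]
  · refine mul_le_mul_of_nonneg_left (mul_le_mul_of_nonneg_right ?_ ?_) (pow_nonneg hB0 4)
    · calc ∏ i, ((Adm (X' i)).card : ℝ) ≤ ∏ _i : Fin 4, (ρ₁ : ℝ) := prod_le_prod (fun i _ => Nat.cast_nonneg _) fun i _ => hAdmCard _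
        _ = (ρ₁ : ℝ) ^ 4 := by rw [prod_const, card_univ, Fintype.card_fin]
    · exact mul_nonneg (Nat.cast_nonneg _) (sum_nonneg fun s _ => hT0 s)


/-- **The E.5 block bounded at ANY pair labels, HYBRID form** (no plateau condition on the labels): §1 for the pair augmented by the points at the four
external momenta (`pointAugment`/`pointAugmentFat`, `…E5PointAugment`); multiplicity `ρ₁ + 4`. [cite: BenfattoGiulianiMastropietro2006, §2.7 (2.70)] -/
theorem norm_klE5Block_le_of_hybridTails_pointAugment (hβ : β ≠ 0) (F Ft : Fin N → FreqMomentum L M → ℂ)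
    (hFF : ∀ ω k, Ft ω k * F ω k = F ω k) (hF0 : ∀ k, ∑ ω, F ω k = 0 → ∀ ω, F ω k = 0) (hFt : ∀ ω k, ‖Ft ω k‖ ≤ 1)
    {ρ₁ : ℕ} (hρ₁ : ∀ k : FreqMomentum L M, ((univ : Finset (Fin N)).filter fun ω => Ft ω k ≠ 0).card ≤ ρ₁)
    (hĊ : ∀ X Y, klE5DressedSliceDeriv L M β μ K n₀ κ Λ X Y ≠ 0 → ∑ ω, F ω X.1.1 = 1 ∧ ∑ ω, F ω Y.1.1 = 1)
    (hD : ∀ X Y, (klE5Total L M β μ K n₀ κ - klE5DressedSlice L M β μ K n₀ κ Λ) X Y ≠ 0 → ∑ ω, F ω X.1.1 = 1 ∧ ∑ ω, F ω Y.1.1 = 1)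
    (p : (Fin 4 → Fin 2) → Fin 4) (T : (Fin 4 → Fin 2) → ℝ) (hT0 : ∀ s, 0 ≤ T s)
    (hT : ∀ (s : Fin 4 → Fin 2) (σ : Fin 4 → SectorLeg (N + 4)) (xp : SpaceTimeIdx L M),
      ∑ i ∈ Finset.Icc 2 (Fintype.card (HubbardFieldIdx L M × Fin 2) + 1), ((i.factorial : ℝ))⁻¹ *
        ∑ Z ∈ univ.filter (fun Z : Fin 4 → SpaceTimeIdx L M × SectorLeg (N + 4) => Z (p s) = (xp, σ (p s)) ∧ ∀ j, (Z j).2 = σ j),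
        ‖kernel ℂ ((grassmannLaplacian ℂ (crossCov ℂ ((sectorSubMatrix L M β (pointAugmentFat F Ft (klE5ExtMomenta Qm x y))).transpose *
              (klE5Total L M β μ K n₀ κ - klE5DressedSlice L M β μ K n₀ κ Λ) * sectorSubMatrix L M β (pointAugmentFat F Ft (klE5ExtMomenta Qm x y)))) ^ i *
            grassmannLaplacian ℂ (crossCov ℂ ((sectorSubMatrix L M β (pointAugmentFat F Ft (klE5ExtMomenta Qm x y))).transpose *
              klE5DressedSliceDeriv L M β μ K n₀ κ Λ * sectorSubMatrix L M β (pointAugmentFat F Ft (klE5ExtMomenta Qm x y)))))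
          (dblCopy ℂ 0 (sectorPreimage β (pointAugment F (klE5ExtMomenta Qm x y)) (klE5Carrier L M β μ K n₀ κ V Λ)) *
            dblCopy ℂ 1 (sectorPreimage β (pointAugment F (klE5ExtMomenta Qm x y)) (klE5Carrier L M β μ K n₀ κ V Λ)))) 4 (fun j => (Z j, s j))‖ ≤
        T s) :
    ‖klE5Block L M β μ K n₀ κ V Λ Qm x y‖ ≤ ((4 : ℕ).factorial : ℝ) * |β * (L : ℝ) ^ 2| ^ 3 *
      (‖((1 / (β * (L : ℝ) ^ 2) : ℝ) : ℂ)‖ ^ 4 * (((ρ₁ + 4 : ℕ) : ℝ) ^ 4 * (Fintype.card (SpaceTimeIdx L M) * ∑ s : Fin 4 → Fin 2, T s))) := by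
  have h := norm_klE5Block_le_of_hybridTails β μ K n₀ κ V Λ Qm x y hβ (pointAugment F (klE5ExtMomenta Qm x y))
    (pointAugmentFat F Ft (klE5ExtMomenta Qm x y)) (pointAugmentFat_mul_pointAugment F Ft _ hFF) (pointAugment_eq_zero_of_sum_eq_zero F _ hF0)
    (norm_pointAugmentFat_le_one F Ft _ hFt) (card_filter_pointAugmentFat_ne_zero_le F Ft _ hρ₁)
    (fun X Y h => ⟨sum_pointAugment_eq_one_of_eq_one F _ (hĊ X Y h).1, sum_pointAugment_eq_one_of_eq_one F _ (hĊ X Y h).2⟩)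
    (fun X Y h => ⟨sum_pointAugment_eq_one_of_eq_one F _ (hD X Y h).1, sum_pointAugment_eq_one_of_eq_one F _ (hD X Y h).2⟩)
    (sum_pointAugment_eq_one_of_exists F _ ⟨3, rfl⟩) (sum_pointAugment_eq_one_of_exists F _ ⟨2, rfl⟩)
    (sum_pointAugment_eq_one_of_exists F _ ⟨0, rfl⟩) (sum_pointAugment_eq_one_of_exists F _ ⟨1, rfl⟩) p T hT0 hT
  simpa only [Nat.cast_add, Nat.cast_ofNat] using h

end BlockBound

/-! ## §2 The colouring-wise HYBRID tails re-indexed by the line number `k = i + 1` (`…GramTailHybrid` `_mul` forms, `e'` explicit soft lines) -/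

section Tails

variable {L M N : ℕ} [NeZero L] {ι : Type*} [Fintype ι] [DecidableEq ι]

omit [Fintype ι] [DecidableEq ι] in
/-- Matching the block's `i`-th term (`Δ_×(D)^i·Δ_×(g)`, weight `(i!)⁻¹`) with the bridge's `k = i + 1`-line list (two-symbol family, line `0` = `g`). -/
private theorem pow_mul_eq_listProd_hyb (S : Matrix (HubbardFieldIdx L M) (SpaceTimeIdx L M × SectorLeg N) ℂ)
    (sym : ι → FreqMomentum L M × Fin 2 → ℂ) (s₀ s₁ : ι) (i : ℕ) :
    grassmannLaplacian ℂ (crossCov ℂ (S.transpose * normalCovariance L M (sym s₁) * S)) ^ i *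
        grassmannLaplacian ℂ (crossCov ℂ (S.transpose * normalCovariance L M (sym s₀) * S)) =
      ((List.ofFn fun j : Fin (i + 1) => grassmannLaplacian ℂ (crossCov ℂ
        (S.transpose * normalCovariance L M (sym (if (j : ℕ) = 0 then s₀ else s₁)) * S))).reverse).prod := by
  rw [← listProd_ite_zero_eq_pow_mul ℂ (S.transpose * normalCovariance L M (sym s₀) * S) (S.transpose * normalCovariance L M (sym s₁) * S) i]
  congr 2
  refine congrArg List.ofFn (funext fun j => ?_)
  split_ifs <;> rfl

/-- **The `(i!)⁻¹`-weighted HYBRID tail from line data, generic vertices** (main form: `m₀ ≥ 1` output legs from `a`, pinned at `p` with `s p = 0`;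
`e'` explicit lines of symbol `s₁` besides line `0` of symbol `s₀`; line numbers `k = i + 1 ∈ Icc (e'+1) (Nm+1)`):
`Σ_{i∈Icc e' Nm} (i!)⁻¹ Σ_{Z : Z p = z, labels Ωo}‖kernel((Δ_×(Sᵀ·nC(s₁)·S)^i·Δ_×(Sᵀ·nC(s₀)·S))(Ga′⁰Gb′¹)) m (Z,s)‖ ≤ ((m₀+m₁+(e'+1)+1)!/(m!(1−x)^{m₀+m₁+(e'+1)+2}))·(α·(δ·4ρ₀)^{e'}·A)`.
[cite: BenfattoGiulianiMastropietro2006, §2.8 (2.80)] -/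
theorem sum_norm_kernel_pow_mul_sectorPreimage_le_gramTailHybrid {e' m m₀ m₁ Nm : ℕ} {β : ℝ} (hβ : 0 ≤ β)
    (F Ft : Fin N → FreqMomentum L M → ℂ)
    {ρ₀ : ℕ} (hρ₀ : ∀ ω : Fin N, ((univ : Finset (Fin N)).filter fun ω' => ∃ q, Ft ω q * Ft ω' q ≠ 0).card ≤ ρ₀)
    (sym : ι → FreqMomentum L M × Fin 2 → ℂ) (s₀ s₁ : ι) (κ : ι → ℝ)
    (hκF : ∀ (t : ι) (Y : SpaceTimeIdx L M × SectorLeg N), Y.2.2 = 0 → ‖sectorGramF L M β Ft (sym t) Y‖ ≤ κ t)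
    (hκG : ∀ (t : ι) (Y : SpaceTimeIdx L M × SectorLeg N), Y.2.2 = 1 → ‖sectorGramG L M β Ft (sym t) Y‖ ≤ κ t)
    (Ga Gb : HubbardGrassmann L M) (s : Fin m → Fin 2)
    (hm₀ : (univ.filter fun i => s i = 0).card = m₀) (hm₁ : (univ.filter fun i => s i = 1).card = m₁) (p : Fin m) (hp : s p = 0)
    (z : SpaceTimeIdx L M × SectorLeg N) (Ωo : Fin m → SectorLeg N) {α : ℝ} (hα : 0 ≤ α)
    (hrow : ∀ X, ∑ Y, ‖((sectorSubMatrix L M β Ft).transpose * normalCovariance L M (sym s₀) * sectorSubMatrix L M β Ft) X Y‖ ≤ α)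
    (hcol : ∀ Y, ∑ X, ‖((sectorSubMatrix L M β Ft).transpose * normalCovariance L M (sym s₀) * sectorSubMatrix L M β Ft) X Y‖ ≤ α)
    {δ : ℝ} (hδ : 0 ≤ δ) (hent : ∀ X Y, ‖((sectorSubMatrix L M β Ft).transpose * normalCovariance L M (sym s₁) * sectorSubMatrix L M β Ft) X Y‖ ≤ δ)
    (Na Nb : ℕ → ℝ) (hNb0 : ∀ k, 0 ≤ Nb k)
    (hNa : ∀ k ∈ Icc (e' + 1) (Nm + 1), ∀ σ₀ : Fin m₀ → SectorLeg N, hubbardSectorKernelNorm L M β F (prescribedTuples univ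
      (Fin.append (fun _ : Fin k => (none : Option (SectorLeg N))) (fun j => some (σ₀ j)))) Ga ≤ Na k)
    (hNb : ∀ k ∈ Icc (e' + 1) (Nm + 1), ∀ (ω₀ : SectorLeg N) (τ' : Fin e' → SectorLeg N) (σ₁ : Fin m₁ → SectorLeg N),
      hubbardSectorKernelNorm L M β F (prescribedTuples univ
        (Fin.append (fun i : Fin k => if h : (i : ℕ) < e' + 1 then
          (Fin.cons (some ω₀) (fun j => some (τ' j)) : Fin (e' + 1) → Option (SectorLeg N)) ⟨i, h⟩ else none) (fun j => some (σ₁ j)))) Gb ≤ Nb k)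
    {x A : ℝ} (hx0 : 0 ≤ x) (hx1 : x < 1) (hA : 0 ≤ A)
    (henv : ∀ k ∈ Icc (e' + 1) (Nm + 1),
      (∑ t, κ t ^ 2) ^ (k - (e' + 1)) * ((imagTimeWeight β M * Na k) * (imagTimeWeight β M * Nb k)) ≤ x ^ (k - (e' + 1)) * A) :
    ∑ i ∈ Icc e' Nm, ((i.factorial : ℝ))⁻¹ *
      ∑ Z ∈ univ.filter (fun Z : Fin m → SpaceTimeIdx L M × SectorLeg N => Z p = z ∧ ∀ j, (Z j).2 = Ωo j),
        ‖kernel ℂ ((grassmannLaplacian ℂ (crossCov ℂ ((sectorSubMatrix L M β Ft).transpose * normalCovariance L M (sym s₁) * sectorSubMatrix L M β Ft)) ^ i *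
            grassmannLaplacian ℂ (crossCov ℂ ((sectorSubMatrix L M β Ft).transpose * normalCovariance L M (sym s₀) * sectorSubMatrix L M β Ft)))
          (dblCopy ℂ 0 (sectorPreimage β F Ga) * dblCopy ℂ 1 (sectorPreimage β F Gb))) m (fun j => (Z j, s j))‖ ≤
      (((m₀ + m₁ + (e' + 1) + 1).factorial : ℝ) / (m.factorial * (1 - x) ^ (m₀ + m₁ + (e' + 1) + 2))) *
        (α * (δ * ((4 * ρ₀ : ℕ) : ℝ)) ^ e' * A) := by
  have h := sum_norm_kernel_crossContract_sectorPreimage_le_gramTailHybrid_mul (Nmax := Nm + 1) hβ F Ft hρ₀ sym s₀ s₁ κ hκF hκG Ga Gb s hm₀ hm₁ p hp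
    z Ωo hα hrow hcol hδ hent Na Nb hNb0 hNa hNb hx0 hx1 hA henv
  rw [← sum_Icc_succ_shift] at h
  refine le_trans (le_of_eq (sum_congr rfl fun i _ => ?_)) h
  rw [Nat.add_sub_cancel, pow_mul_eq_listProd_hyb]

/-- **The same, pinned at an output leg of `b`** (`s p = 1`; `Ga` read at «line-`0` leg, explicit sectors, outputs prescribed», `Gb` at «contracted
legs free, outputs prescribed»). [cite: BenfattoGiulianiMastropietro2006, §2.8 (2.80)] -/
theorem sum_norm_kernel_pow_mul_sectorPreimage_le_gramTailHybrid_of_b {e' m m₀ m₁ Nm : ℕ} {β : ℝ} (hβ : 0 ≤ β)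
    (F Ft : Fin N → FreqMomentum L M → ℂ)
    {ρ₀ : ℕ} (hρ₀ : ∀ ω : Fin N, ((univ : Finset (Fin N)).filter fun ω' => ∃ q, Ft ω q * Ft ω' q ≠ 0).card ≤ ρ₀)
    (sym : ι → FreqMomentum L M × Fin 2 → ℂ) (s₀ s₁ : ι) (κ : ι → ℝ)
    (hκF : ∀ (t : ι) (Y : SpaceTimeIdx L M × SectorLeg N), Y.2.2 = 0 → ‖sectorGramF L M β Ft (sym t) Y‖ ≤ κ t)
    (hκG : ∀ (t : ι) (Y : SpaceTimeIdx L M × SectorLeg N), Y.2.2 = 1 → ‖sectorGramG L M β Ft (sym t) Y‖ ≤ κ t)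
    (Ga Gb : HubbardGrassmann L M) (s : Fin m → Fin 2)
    (hm₀ : (univ.filter fun i => s i = 0).card = m₀) (hm₁ : (univ.filter fun i => s i = 1).card = m₁) (p : Fin m) (hp : s p = 1)
    (z : SpaceTimeIdx L M × SectorLeg N) (Ωo : Fin m → SectorLeg N) {α : ℝ} (hα : 0 ≤ α)
    (hrow : ∀ X, ∑ Y, ‖((sectorSubMatrix L M β Ft).transpose * normalCovariance L M (sym s₀) * sectorSubMatrix L M β Ft) X Y‖ ≤ α)
    (hcol : ∀ Y, ∑ X, ‖((sectorSubMatrix L M β Ft).transpose * normalCovariance L M (sym s₀) * sectorSubMatrix L M β Ft) X Y‖ ≤ α)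
    {δ : ℝ} (hδ : 0 ≤ δ) (hent : ∀ X Y, ‖((sectorSubMatrix L M β Ft).transpose * normalCovariance L M (sym s₁) * sectorSubMatrix L M β Ft) X Y‖ ≤ δ)
    (Na Nb : ℕ → ℝ) (hNa0 : ∀ k, 0 ≤ Na k)
    (hNa : ∀ k ∈ Icc (e' + 1) (Nm + 1), ∀ (ω₀ : SectorLeg N) (τ' : Fin e' → SectorLeg N) (σ₀ : Fin m₀ → SectorLeg N),
      hubbardSectorKernelNorm L M β F (prescribedTuples univ
        (Fin.append (fun i : Fin k => if h : (i : ℕ) < e' + 1 then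
          (Fin.cons (some ω₀) (fun j => some (τ' j)) : Fin (e' + 1) → Option (SectorLeg N)) ⟨i, h⟩ else none) (fun j => some (σ₀ j)))) Ga ≤ Na k)
    (hNb : ∀ k ∈ Icc (e' + 1) (Nm + 1), ∀ σ₁ : Fin m₁ → SectorLeg N, hubbardSectorKernelNorm L M β F (prescribedTuples univ
      (Fin.append (fun _ : Fin k => (none : Option (SectorLeg N))) (fun j => some (σ₁ j)))) Gb ≤ Nb k)
    {x A : ℝ} (hx0 : 0 ≤ x) (hx1 : x < 1) (hA : 0 ≤ A)
    (henv : ∀ k ∈ Icc (e' + 1) (Nm + 1),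
      (∑ t, κ t ^ 2) ^ (k - (e' + 1)) * ((imagTimeWeight β M * Na k) * (imagTimeWeight β M * Nb k)) ≤ x ^ (k - (e' + 1)) * A) :
    ∑ i ∈ Icc e' Nm, ((i.factorial : ℝ))⁻¹ *
      ∑ Z ∈ univ.filter (fun Z : Fin m → SpaceTimeIdx L M × SectorLeg N => Z p = z ∧ ∀ j, (Z j).2 = Ωo j),
        ‖kernel ℂ ((grassmannLaplacian ℂ (crossCov ℂ ((sectorSubMatrix L M β Ft).transpose * normalCovariance L M (sym s₁) * sectorSubMatrix L M β Ft)) ^ i *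
            grassmannLaplacian ℂ (crossCov ℂ ((sectorSubMatrix L M β Ft).transpose * normalCovariance L M (sym s₀) * sectorSubMatrix L M β Ft)))
          (dblCopy ℂ 0 (sectorPreimage β F Ga) * dblCopy ℂ 1 (sectorPreimage β F Gb))) m (fun j => (Z j, s j))‖ ≤
      (((m₀ + m₁ + (e' + 1) + 1).factorial : ℝ) / (m.factorial * (1 - x) ^ (m₀ + m₁ + (e' + 1) + 2))) *
        (α * (δ * ((4 * ρ₀ : ℕ) : ℝ)) ^ e' * A) := by
  have h := sum_norm_kernel_crossContract_sectorPreimage_le_gramTailHybrid_mul_of_b (Nmax := Nm + 1) hβ F Ft hρ₀ sym s₀ s₁ κ hκF hκG Ga Gb s hm₀ hm₁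
    p hp z Ωo hα hrow hcol hδ hent Na Nb hNa0 hNa hNb hx0 hx1 hA henv
  rw [← sum_Icc_succ_shift] at h
  refine le_trans (le_of_eq (sum_congr rfl fun i _ => ?_)) h
  rw [Nat.add_sub_cancel, pow_mul_eq_listProd_hyb]

end Tails

end Summit.HubbardSuperconductivity.HubbardSuperconductivity.Theorems.KLRegimeSplit

end
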